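import Mathlib
import Summits.ValiantsHypothesis.ValiantsHypothesis.Theorems.GrenetZeonHessianRankCodimTwoBorderFrobeniusCongr
import Summits.ValiantsHypothesis.ValiantsHypothesis.Theorems.GrenetZeonHessianRankCodimTwoBorderLowSum
import HarnessLib

/-!
# Crux `GrenetZeon.HessianRankCodimTwo` (stmt-ValiantsHypothesis-8061), line `good_plane`, ALL large `n`:
# the Frobenius congruences of the bordered Latin plane, III — homogeneity, change of ring, evaluated forms

Seat val-width-8061-p1 g2 (memo `Cruxes/HessianRankCodimTwo/BorderedLatinAllN.md`, §2–3).  For the reduction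
modulo `p` (`le_card_ne_zero_of_charP`, file `…CharPTransfer`) one needs the INTEGER polynomials `bordPhi ℤ p r`,
`bordPsi ℤ p r I J` to be homogeneous and their values at points `w` of a field of characteristic `p`:

* `bordPhi_isHomogeneous` (degree `3p + r`), `bordPsi_isHomogeneous` (degree `3p + r - 2`);
* `map_bordPhi`, `map_bordPsi`, `map_bordLow` (change of coefficient ring);
* `aeval_bordEnt` and the seven explicit border forms (`aeval_bordEnt_u0`, …, `aeval_bordEnt_w`);
* `aeval_bordPhi_int` — `Φ(w) = F(w)^p · W(w)^r`, `W(w) = -4w_0 + 2w_1 + w_2`;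
* `aeval_bordPsi_int` — `Ψ_{IJ}(w) = P_d(w)^p · w_d^{p-2-r} (w_d W - U_I V_J)^{r-1} (w_d W - (r+1) U_I V_J)` (`1 ≤ r ≤ p-2`);
* the DEATH CRITERIA in a domain: `Φ(w) = 0 → F(w) = 0 ∨ W(w) = 0` (`curve_of_aeval_bordPhi_eq_zero`) and
  `Ψ_{IJ}(w) = 0 → P_d(w) = 0 ∨ w_d = 0 ∨ w_d W = U_I V_J ∨ w_d W = (r+1) U_I V_J` (`dead_of_aeval_bordPsi_eq_zero`).

VP ≠ VNP is not moved by anything here.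
-/

noncomputable section

open MvPolynomial Finset

-- single-conjunct layout `Summits/ValiantsHypothesis/ValiantsHypothesis`: duplicated namespace by design
set_option linter.dupNamespace false

namespace Summit.ValiantsHypothesis.ValiantsHypothesis.Theorems.GrenetZeonHessianRankCodimTwo

variable {R : Type*} [CommRing R]

/-! ### Homogeneity -/

/-- The entries are linear forms. [folklore] -/
theorem bordEnt_isHomogeneous (I J : Option (Fin 3)) : (bordEnt R I J).IsHomogeneous 1 := by
  unfold bordEnt
  refine IsHomogeneous.sum _ _ _ fun d _ => ?_
  rw [show ((bordCoef I J d : ℤ) : MvPolynomial (Fin 3) R) = C ((bordCoef I J d : ℤ) : R) by simp]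
  exact isHomogeneous_C_mul_X _ _

/-- Coefficients of a product of row forms `Π_i ℓ_{blk i}` are homogeneous of degree `|ι|` in the
coordinates. [folklore] -/
theorem isHomogeneous_coeff_prod_bordRowForm {ι : Type*} [Fintype ι] (blk : ι → Option (Fin 3))
    (ν : Option (Fin 3) →₀ ℕ) :
    (coeff ν (∏ i, bordRowForm R (blk i))).IsHomogeneous (Fintype.card ι) := by
  classical
  have h := coeff_prod_sum_C_mul_X_pow (A := MvPolynomial (Fin 3) R)
    (fun i J => bordEnt R (blk i) J) (fun _ => 1) ν
  simp only [pow_one] at h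
  change (coeff ν (∏ i, ∑ J, C (bordEnt R (blk i) J) * X J)).IsHomogeneous _
  rw [h]
  refine IsHomogeneous.sum _ _ _ fun g _ => ?_
  have h' := IsHomogeneous.prod Finset.univ (fun i => bordEnt R (blk i) (g i)) (fun _ => 1)
    fun i _ => bordEnt_isHomogeneous _ _
  simpa using h'

/-- `Φ` is homogeneous of degree `3p + r`. [folklore] -/
theorem bordPhi_isHomogeneous (p r : ℕ) : (bordPhi R p r).IsHomogeneous (3 * p + r) := by
  have h := isHomogeneous_coeff_prod_bordRowForm (R := R)
    (Sum.elim (fun x : Fin 3 × Fin p => some x.1) (fun _ : Fin r => none)) (bordNuPer p r)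
  rw [Fintype.prod_sum_type, Fintype.prod_prod_type] at h
  simp only [Sum.elim_inl, Sum.elim_inr, Finset.prod_const, Finset.card_univ, Fintype.card_fin,
    Fintype.card_sum, Fintype.card_prod] at h
  exact h

/-- `Ψ_{IJ}` is homogeneous of degree `3p + r - 2` (`p ≥ 2`). [folklore] -/
theorem bordPsi_isHomogeneous (p r : ℕ) (hp : 2 ≤ p) (I J : Fin 3) :
    (bordPsi R p r I J).IsHomogeneous (3 * p + r - 2) := by
  have h := isHomogeneous_coeff_prod_bordRowForm (R := R)
    (Sum.elim (Sum.elim (fun _ : Fin (p - 2) => some I)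
      (Sum.elim (fun _ : Fin p => some (I + 1)) (fun _ : Fin p => some (I + 2)))) (fun _ : Fin r => none))
    (bordNuBlock p r J)
  rw [Fintype.prod_sum_type, Fintype.prod_sum_type, Fintype.prod_sum_type] at h
  simp only [Sum.elim_inl, Sum.elim_inr, Finset.prod_const, Finset.card_univ, Fintype.card_fin,
    Fintype.card_sum] at h
  rw [show p - 2 + (p + p) + r = 3 * p + r - 2 by omega] at h
  exact h

/-! ### Change of coefficient ring -/

section Map

variable {S : Type*} [CommRing S] (f : R →+* S)

/-- The entries are defined over `ℤ`. [folklore] -/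
theorem map_bordEnt (I J : Option (Fin 3)) : MvPolynomial.map f (bordEnt R I J) = bordEnt S I J := by
  simp [bordEnt, map_X]

/-- The row forms are defined over `ℤ`. [folklore] -/
theorem map_bordRowForm (I : Option (Fin 3)) :
    MvPolynomial.map (MvPolynomial.map f) (bordRowForm R I) = bordRowForm S I := by
  simp [bordRowForm_def, map_X, map_C, map_bordEnt]

/-- `Φ` commutes with change of coefficients. [folklore] -/
theorem map_bordPhi (p r : ℕ) : MvPolynomial.map f (bordPhi R p r) = bordPhi S p r := by
  rw [bordPhi, bordPhi, ← coeff_map, map_mul, map_prod, map_pow]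
  simp_rw [map_pow, map_bordRowForm]

/-- `Ψ_{IJ}` commutes with change of coefficients. [folklore] -/
theorem map_bordPsi (p r : ℕ) (I J : Fin 3) :
    MvPolynomial.map f (bordPsi R p r I J) = bordPsi S p r I J := by
  rw [bordPsi, bordPsi, ← coeff_map]
  simp only [map_mul, map_pow, map_bordRowForm]

/-- `bordLow` commutes with change of coefficients. [folklore] -/
theorem map_bordLow (p r : ℕ) (I J : Fin 3) :
    MvPolynomial.map f (bordLow R p r I J) = bordLow S p r I J := by
  rw [bordLow, bordLow, map_sum]
  refine Finset.sum_congr rfl fun t _ => ?_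
  simp [map_X, map_bordEnt]

end Map

/-! ### Evaluated forms in characteristic `p` -/

section Eval

variable {L : Type*} [CommRing L]

/-- Evaluating an entry form. [folklore] -/
theorem aeval_bordEnt (w : Fin 3 → L) (I J : Option (Fin 3)) :
    aeval w (bordEnt ℤ I J) = ∑ d, (bordCoef I J d : L) * w d := by
  simp [bordEnt, map_sum]

/-- `u_0(w) = 2w_0 + w_1`. [folklore] -/
theorem aeval_bordEnt_u0 (w : Fin 3 → L) : aeval w (bordEnt ℤ (some 0) none) = 2 * w 0 + w 1 := by
  rw [aeval_bordEnt]; simp [bordCoef, bordU, Fin.sum_univ_three]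

/-- `u_1(w) = w_0 + w_1`. [folklore] -/
theorem aeval_bordEnt_u1 (w : Fin 3 → L) : aeval w (bordEnt ℤ (some 1) none) = w 0 + w 1 := by
  rw [aeval_bordEnt]; simp [bordCoef, bordU, Fin.sum_univ_three]

/-- `u_2(w) = 3w_0 + 2w_1`. [folklore] -/
theorem aeval_bordEnt_u2 (w : Fin 3 → L) : aeval w (bordEnt ℤ (some 2) none) = 3 * w 0 + 2 * w 1 := by
  rw [aeval_bordEnt]; simp [bordCoef, bordU, Fin.sum_univ_three]

/-- `v_0(w) = 3w_0 + 5w_1`. [folklore] -/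
theorem aeval_bordEnt_v0 (w : Fin 3 → L) : aeval w (bordEnt ℤ none (some 0)) = 3 * w 0 + 5 * w 1 := by
  rw [aeval_bordEnt]; simp [bordCoef, bordV, Fin.sum_univ_three]

/-- `v_1(w) = 4w_0 + 5w_1`. [folklore] -/
theorem aeval_bordEnt_v1 (w : Fin 3 → L) : aeval w (bordEnt ℤ none (some 1)) = 4 * w 0 + 5 * w 1 := by
  rw [aeval_bordEnt]; simp [bordCoef, bordV, Fin.sum_univ_three]

/-- `v_2(w) = w_0 - 2w_1`. [folklore] -/
theorem aeval_bordEnt_v2 (w : Fin 3 → L) : aeval w (bordEnt ℤ none (some 2)) = w 0 - 2 * w 1 := by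
  rw [aeval_bordEnt]; simp [bordCoef, bordV, Fin.sum_univ_three]; ring

/-- `w(w) = -4w_0 + 2w_1 + w_2`. [folklore] -/
theorem aeval_bordEnt_w (w : Fin 3 → L) : aeval w (bordEnt ℤ none none) = -4 * w 0 + 2 * w 1 + w 2 := by
  rw [aeval_bordEnt]; simp [bordCoef, bordW, Fin.sum_univ_three]

/-- `L_{IJ}(w) = w_{J-I}` for core blocks. [folklore] -/
theorem aeval_bordEnt_some_some (w : Fin 3 → L) (I J : Fin 3) :
    aeval w (bordEnt ℤ (some I) (some J)) = w (J - I) := by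
  rw [bordEnt_some_some, aeval_X]

variable (p : ℕ) [hp : Fact p.Prime] [CharP L p]

/-- **Evaluated congruence for the permanent:** `Φ(w) = F(w)^p · W(w)^r` (`r < p`). [folklore] -/
theorem aeval_bordPhi_int {r : ℕ} (hr : r < p) (w : Fin 3 → L) :
    aeval w (bordPhi ℤ p r) =
      (w 0 ^ 3 + w 1 ^ 3 + w 2 ^ 3 + 3 * (w 0 * w 1 * w 2)) ^ p * (-4 * w 0 + 2 * w 1 + w 2) ^ r := by
  rw [MvPolynomial.aeval_def, ← MvPolynomial.eval_map, algebraMap_int_eq, map_bordPhi, bordPhi_eq hr,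
    map_mul, map_pow, map_pow, ← aeval_bordEnt_w w, MvPolynomial.aeval_def, ← MvPolynomial.eval_map,
    algebraMap_int_eq, map_bordEnt]
  simp [cubicF]

/-- **Evaluated congruence for the core block values:**
`Ψ_{IJ}(w) = P_d(w)^p · w_d^{p-2-r} · ((w_d W - U_I V_J)^{r-1} · (w_d W - (r+1) U_I V_J))`, `d = J - I`
(`1 ≤ r ≤ p - 2`), with `U_I = u_I(w)`, `V_J = v_J(w)`, `W = w(w)`. [folklore] -/
theorem aeval_bordPsi_int {r : ℕ} (hr1 : 1 ≤ r) (hrp : r + 2 ≤ p) (w : Fin 3 → L) (I J : Fin 3) :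
    aeval w (bordPsi ℤ p r I J) =
      (w (J - I) ^ 2 + w (J - I + 1) * w (J - I + 2)) ^ p *
        (w (J - I) ^ (p - 2 - r) *
          ((w (J - I) * aeval w (bordEnt ℤ none none) -
              aeval w (bordEnt ℤ (some I) none) * aeval w (bordEnt ℤ none (some J))) ^ (r - 1) *
            (w (J - I) * aeval w (bordEnt ℤ none none) -
              ((r + 1 : ℕ) : L) * (aeval w (bordEnt ℤ (some I) none) * aeval w (bordEnt ℤ none (some J)))))) := by
  have hp2 : 2 < p := by omega
  rw [MvPolynomial.aeval_def, ← MvPolynomial.eval_map, algebraMap_int_eq, map_bordPsi,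
    bordPsi_eq hp2 (by omega), map_mul, map_pow, bordLow_eq L p hr1 hrp]
  simp only [MvPolynomial.aeval_def, ← MvPolynomial.eval_map, algebraMap_int_eq, map_bordEnt]
  simp [quadP]

variable [IsDomain L]

/-- **The curve modulo `p`:** a zero of `Φ` has `F(w) = 0` or `W(w) = 0` (`r < p`). [folklore] -/
theorem curve_of_aeval_bordPhi_eq_zero {r : ℕ} (hr : r < p) (w : Fin 3 → L)
    (h : aeval w (bordPhi ℤ p r) = 0) :
    w 0 ^ 3 + w 1 ^ 3 + w 2 ^ 3 + 3 * (w 0 * w 1 * w 2) = 0 ∨ -4 * w 0 + 2 * w 1 + w 2 = 0 := by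
  rw [aeval_bordPhi_int p hr, mul_eq_zero] at h
  rcases h with h | h
  · exact Or.inl ((pow_eq_zero_iff hp.out.ne_zero).mp h)
  · exact Or.inr (pow_eq_zero_iff' |>.mp h).1

/-- **Death criterion modulo `p`:** a zero of `Ψ_{IJ}` (`1 ≤ r ≤ p - 2`) satisfies `P_d(w) = 0`, `w_d = 0`,
`w_d W = U_I V_J` or `w_d W = (r+1) U_I V_J` (`d = J - I`). [folklore] -/
theorem dead_of_aeval_bordPsi_eq_zero {r : ℕ} (hr1 : 1 ≤ r) (hrp : r + 2 ≤ p) (w : Fin 3 → L) (I J : Fin 3)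
    (h : aeval w (bordPsi ℤ p r I J) = 0) :
    w (J - I) ^ 2 + w (J - I + 1) * w (J - I + 2) = 0 ∨ w (J - I) = 0 ∨
      w (J - I) * aeval w (bordEnt ℤ none none) =
        aeval w (bordEnt ℤ (some I) none) * aeval w (bordEnt ℤ none (some J)) ∨
      w (J - I) * aeval w (bordEnt ℤ none none) =
        ((r + 1 : ℕ) : L) * (aeval w (bordEnt ℤ (some I) none) * aeval w (bordEnt ℤ none (some J))) := by
  rw [aeval_bordPsi_int p hr1 hrp] at h
  rcases mul_eq_zero.mp h with h | h
  · exact Or.inl ((pow_eq_zero_iff hp.out.ne_zero).mp h)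
  rcases mul_eq_zero.mp h with h | h
  · exact Or.inr (Or.inl (pow_eq_zero_iff' |>.mp h).1)
  rcases mul_eq_zero.mp h with h | h
  · exact Or.inr (Or.inr (Or.inl (sub_eq_zero.mp (pow_eq_zero_iff' |>.mp h).1)))
  · exact Or.inr (Or.inr (Or.inr (sub_eq_zero.mp h)))

end Eval

end Summit.ValiantsHypothesis.ValiantsHypothesis.Theorems.GrenetZeonHessianRankCodimTwo
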